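import Literature.NumberTheory.EllipticCurves.Kobayashi2003.SignedColemanKatoZeta
import Literature.NumberTheory.EllipticCurves.KuriharaNumber
import Literature.NumberTheory.EllipticCurves.KatoKolyvaginPrimes
import Literature.NumberTheory.EllipticCurves.PAdicHeights
import HarnessLib

/-!
# Kim–Kim–Sun (Selecta Math. 26 (2020)) Thm. 1.1 AT `p = 3`, read on Kobayashi's `η = 1` Coleman/Kato package:
# a UNIT Kurihara number at a cyclic Kolyvagin level gives Kato's main identity for `T_3E` over `ℚ_∞` — as an
# explicitly labelled OPEN hypothesis, because the printed proof does not cover `p = 3` (flag `KKS20@3-MR-H4`: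
# its repair is Sakamoto 2022/2024 [PUBLISHED, artinian step] + C.-H. Kim 2025 Thm. 3.18 [PREPRINT, `Λ`-adic step])

Topic `NumberTheory/EllipticCurves`, sub-directory `KimKimSun2020` (author–year; namespace = path). HONEST FRAMING:
nothing here is asserted about any curve; nothing is booked; BSD is not proved by any of this. This file is the
`p = 3` companion of the PUBLISHED `Kim2026.thm111_katoMainIdentity_of_kuriharaNumber_ne_zero` (C.-H. Kim, AJM 2026
Thm. 1.11 (1) ⟹ (3), `p ≥ 5`, same frame and conclusion) and is written for the cell `bsd-ssimc` (HOME
`run/shared/lean/pub/bsd-ssimc/`), route `SignedLowerHalves`, crux item stmt-BirchSwinnertonDyer-19001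
`KobayashiLowerHalfLargeImage`, line `kurihara_rigidity`, stub `stub_three`: the lead (gen 2) typed the COMPOSITE
binder `KimKimSun2020_thm11_via_kobayashi74_three` («KKS Thm 1.1 at 3 ∘ Kobayashi Thm 7.4», flag displayed,
`Rank1Residual/Supersingular/KobayashiMainConjectureKuriharaRigidityThree.lean`, p611880) and asked the width seat
(this file's author, `bsd-line-slh-p1-w2` g2) for the finer layer «KKS Thm 1.1 read on the package» so that the
Kobayashi-7.4 half becomes the lead's KERNEL theorem `KuriharaRigidity.kobayashiMainConjecture_of_katoMainConjectureFrame_odd`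
(p612293) — exactly as the seat's `p ≥ 5` layer (p607903/p608118/p608428) did. WHY `_OPEN` AND NOT A PLAIN CITE
(the seat's referee reading, evidence `REFEREE-NOTE-19001-w2g2-v2.md` on the item; b2b's open question R-X8):
see «Status at p = 3» below.

## Source, verbatim (C.-H. Kim, M. Kim, H.-S. Sun, *On the indivisibility of derived Kato's Euler systems and the
## main conjecture for modular forms*, Selecta Math. (N.S.) 26 (2020) = arXiv:1709.05780; held text
## `paper:arxiv-1709.05780`, page = chunk file number)

p0008 L5 (§2): "Let `p` be a prime `> 2`." p0004 L10–L30: "**Theorem 1.1 (Main Theorem).** Assume the following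
conditions: (NA) `a_p(f) ≢ 1 (mod λ)` and `a_p(f) ≢ ψ(p) (mod λ)`; (Im) the image of `ρ̄` contains a conjugate of
`SL₂(𝔽_p)`; (Tam) for a prime `q`, `q² ∤ N` if `q ∣ N(ρ̄)` and `q ≡ ±1 (mod p)`; `ord_q(N(ρ̄)) = ord_q(N)`
otherwise. If `δ̃_n := ∑_{a ∈ (ℤ/nℤ)ˣ} ([a/n]⁺_f · ∏_{ℓ∣n} log_{𝔽_ℓ}(a)) ≠ 0 ∈ 𝔽_λ` for some `n`, then (1) the
derived Kato's Euler system does not vanish modulo `λ`, and (2) the Iwasawa main [C] à la Kato (Conjecture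
(conj:kato-main-conjecture)) holds for `(f, ℚ_∞/ℚ)`." p0004 L40–L43: "the first condition of Condition (Tam)
corresponds to the following divisibility criterion `p ∤ (∏_{q∣N_sp}(q−1))·(∏_{q∣N_ns}(q+1))` where `N_sp :=
∏_{q∥N, a_q(f)=1} q` and `N_ns := ∏_{q∥N, a_q(f)=−1} q`. Indeed, if we have `δ̃_n ≠ 0` for some `n`, then the second
condition of Condition (Tam) is automatic (Remark (rem:tamagawa))." p0006 L59–L80 (§1.3): "By Proposition
(prop:Lambda-primitivity) and Theorem (thm:primitivity_kato_main_conjecture) ([mazur-rubin-book]), it suffices to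
check `κ_n ≢ 0 (mod λ)` … most content of this article is devoted to prove `δ̃_n ≠ 0 ⟹ κ_n ≢ 0 (mod λ)`"; §7.4
(p0020 L61–) proves it. p0012 L76–L87: "**Assumption 4.2.** (H.1) … (H.4) Either `Hom_{𝔽_λ[G_ℚ]}(T/λT, A_f(1)[λ])
[= 0] or `p > 4`. **Lemma 4.3 ([mazur-rubin-book]).** Condition (Im) in Theorem 1.1 implies all the conditions of
Assumption 4.2."

## Status at `p = 3` (why this is an OPEN hypothesis; flag `KKS20@3-MR-H4`)

For `f = f_E` one has `T/λT = E[3] ≅ A_f(1)[λ]`, so (H.4a) fails and (H.4b) wants `p > 4`: Lemma 4.3 — hence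
the printed proof of Thm. 1.1, whose steps «κ primitive ⟹ κ^∞ Λ-primitive» (Prop. 4.x, Büyükboduk) and
«Λ-primitive ⟹ main identity» (Mazur–Rubin Thm. 5.3.10 (iii)) run under Assumption 4.2 — does NOT cover `p = 3`
for elliptic curves. The source's own authors say so later: C.-H. Kim, AJM 2026 §1.2.5 («The `p ≥ 5` condition is
required only for the Chebotarev density type argument in [mazur-rubin-book], and it seems possible to extend to
the `p = 3` case following the recent work of Sakamoto»); C.-H. Kim 2025 (arXiv:2505.09121, PREPRINT) §3.2.2
(«When `p = 3` and `Hom(ρ̄, Hom(ρ̄, 𝔽(1))) ≠ 0`, we need a more argument following [sakamoto-p-3]»), Prop. 3.4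
(Sakamoto, `p = 3`), Thm. 3.12 and **Thm. 3.18 (3)** («`κ^{Kato,∞}` is Λ-primitive ⟺ the equality
`char_Λ(H¹_Iw/Λκ₁^∞) = char_Λ(Sel₀(ℚ_∞)^∨)`», stated for `p ≥ 3` under large image). What IS refereed at `3`:
KKS's own mod-`λ` reciprocity `δ̃_n ≠ 0 ⟹ κ_n ≢ 0` (§§5–7, `p > 2`), and R. Sakamoto's `p = 3` Kolyvagin-system
theory with ARTINIAN coefficients (Doc. Math. 27 (2022) App. A; JTNB 36 (2024) Thm. 1.1 / 4.4 / 8.5, typed in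
`Literature/NumberTheory/GaloisCohomology/Sakamoto2024*`). What is NOT refereed at `3`: the Λ-ADIC step, asserted
only in Kim 2025 Thm. 3.18 («Proof. See [kato-euler-systems] and [mazur-rubin-book]»). Hence this binder is
`_OPEN` / claim-grade at `p = 3` — weaker labelling than the printed «`p > 2`», by design; a referee ruling that
the flag is bookable would upgrade it to a cite of Thm. 1.1 verbatim. (At `p ≥ 5` the statement is the published
companion's, with (Tam) in place of nothing; not repeated here.)

## Transcription (weaker than print; flags)

Frame = the companion's and the package fact's (`W/ℚ` globally minimal, structure facts of `T_pW` as instance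
BINDERS, a newform `f` of `W` at any level, the period ratio `ϖ`, the cyclotomic `(κ, γ)` matching the variable),
at `p = 3` GOOD with `a₃ = 0` ((NA): `a_p ≢ 1`, automatic; `ψ = 1`). (Im) as `W.HasSurjectiveModNGaloisRep 3` AND
the whole tower `ρ̄_{W,3ⁿ}` onto for all `n` (reading `KKS20-tower` of the composite binder: Kato's (12.5.2) wants
`SL₂(ℤ₃)` in the image; weaker than print; a theorem on the supersingular classes, `GoodSS.towerSurj_of_surj`).
(Tam), first clause, spelled on the multiplicative primes of `W` exactly as the composite binder's predicate
`KimKimSun2020TamAt W 3` (split ⟹ `3 ∤ q − 1`, non-split ⟹ `3 ∤ q + 1`; reading `KKS20-Tam`; the second clause is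
automatic under the certificate, p0004 L43). The period transfer `Ω(W) = u·Ω⁺_f`, `|u|₃ = 1` (reading
`KKS20-can-period`: KKS normalise by Vatsal's canonical period; units apart from `Ω⁺_f`/`Ω(W)` under (Im); the tree's
`p = 3` period fact `realPeriodRat_eq_unit_mul_plusPeriod_three` supplies it at a good `3` with `E[3]` irreducible).
The certificate exactly as in the companion: a CYCLIC Kolyvagin level `n ∈ 𝒩₁(W,3)` (reading `KR-cyclic-levels`),
surjective discrete logarithms `ψ_ℓ`, `kuriharaNumber f 3 n ψ ≠ 0`. CONCLUSION = the companion's: KKS Conj. 3.3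
(= Kobayashi §5 = Kato Conj. 12.10; Prop. 3.4: independent of the finite-index choice of zeta element — reading
`KR-IMC-forms`) read on the sign-`ε` package for every `ε`: for all pinned `I`, `Y` some datum `d` with
`Module.charIdeal Λ Y.X = Module.charIdeal Λ (I.H ⧸ d.Z)`. NEVER cite this `Prop` as a theorem at `p = 3`; take it as
an explicit hypothesis `(hKKS3 : …)`. Nothing asserted.

What this binder is NOT: not KKS Thm. 1.1 at `p ≥ 5` (use `Kim2026.thm111_katoMainIdentity_of_kuriharaNumber_ne_zero`);
not Kobayashi's signed main [C] (derived Summits-side by the kernel Thm. 7.4 at odd `p`); not Kurihara's [C] at `3`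
(the existence of the certificate — the line's open statement `X4.KuriharaUnitAt W 3 f`); not Cor. 1.2/1.7 of the
source (ordinary / Hida-family spreading); not a statement for `3 ∣ Tam_E` rows (no engine in print or preprint).

## References

* C.-H. Kim, M. Kim, H.-S. Sun, Selecta Math. (N.S.) 26 (2020), Paper No. 31 = arXiv:1709.05780: Thm. 1.1 and
  (Tam) (p. 4), Rem. 2.1–2.3 (p. 9), §1.3 (p. 6), Conj. 3.3, Prop. 3.4, Assumption 4.2, Lemma 4.3 (p. 12), §5.4,
  §7.4 (p. 20), §8.2.2. [KimKimSun2020]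
* R. Sakamoto, Doc. Math. 27 (2022), App. A; J. Théor. Nombres Bordeaux 36 (2024) 919–946, Thm. 1.1, Thm. 4.4,
  Thm. 8.5. [Sakamoto2022pSelmer] [Sakamoto2024KolyvaginThree]
* C.-H. Kim (app. R. Pollack), arXiv:2505.09121v1 (2025): §3.2.2, Prop. 3.4, Thm. 3.12, Thm. 3.18 (PREPRINT).
  [Kim2025RefinedTNC]
* C.-H. Kim, Amer. J. Math. 148 (2026) = arXiv:2203.12159: §1.2.5, Thm. 1.11. [Kim2022StructureSelmer]
* B. Mazur, K. Rubin, Mem. AMS 799 (2004): §3.5 (H.4), Thm. 5.3.10. [MazurRubin2004]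
* S. Kobayashi, Invent. Math. 152 (2003): §5 (p. 10), Prop. 7.1 ii) (p. 12), Thm. 7.3–7.4 (p. 13). [Kobayashi2003]
* C. Wuthrich, *An introduction to Euler systems* / J. Lond. Math. Soc. 2014, Lemma 20 (tower surjectivity). [Wuthrich2014]
-/

noncomputable section

open scoped Classical MatrixGroups ModularForm

open CongruenceSubgroup WeierstrassCurve Field Literature.NumberTheory.EllipticCurves
  Literature.NumberTheory.EllipticCurves.ModularForms Literature.NumberTheory.GaloisRepresentations

namespace Literature.NumberTheory.EllipticCurves.KimKimSun2020

/-- **OPEN HYPOTHESIS at `p = 3` (flag `KKS20@3-MR-H4`) — Kim–Kim–Sun, Selecta Math. 26 (2020) Thm. 1.1 for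
`f = f_E` AT `p = 3`, Kato's main identity [C] read on Kobayashi's `η = 1` Coleman/Kato package.** Source
(printed «`p > 2`», PDF p. 4): "Assume (NA), (Im), (Tam). If `δ̃_n ≠ 0 ∈ 𝔽_λ` for some `n`, then … the Iwasawa
main [C] à la Kato holds for `(f, ℚ_∞/ℚ)`." STATUS AT `p = 3` (module docstring): the printed proof's Lemma 4.3
takes Mazur–Rubin (H.4b) `p > 4` from (Im), false for `E[3] ≅ E[3]^*`; the `p = 3` repair is Sakamoto 2022 App. A /
2024 Thm. 1.1 [PUBLISHED, artinian coefficients] plus the Λ-adic step asserted only in C.-H. Kim 2025 Thm. 3.18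
[PREPRINT] — hence `_OPEN`/claim-grade, never a theorem. TRANSCRIBED on the companion's frame
(`Kim2026.thm111_katoMainIdentity_of_kuriharaNumber_ne_zero`): `W/ℚ` globally minimal, `p = 3` GOOD with `a₃ = 0`
((NA) automatic), a newform `f` of `W`, period ratio `ϖ`, cyclotomic `(κ, γ)` matching the variable; (Im) as `ρ̄`
onto PLUS the `3`-adic tower onto (reading `KKS20-tower`); (Tam) first clause on the multiplicative primes
(reading `KKS20-Tam`, spelled as the composite binder's `KimKimSun2020TamAt W 3`); the period transfer
`Ω(W) = u·Ω⁺_f`, `|u|₃ = 1` (reading `KKS20-can-period`); the certificate = a CYCLIC Kolyvagin level `n ∈ 𝒩₁(W,3)`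
with surjective discrete logarithms and `kuriharaNumber f 3 n ψ ≠ 0` (reading `KR-cyclic-levels`) ⟹ for every sign
`ε`, all pinned `I : Kato2004.IwasawaH1Data W 3 κ γ`, `Y : W.FineSelmerDualData κ γ`, some package datum `d` with
`Module.charIdeal Λ Y.X = Module.charIdeal Λ (I.H ⧸ d.Z)` (readings `KR-IMC-forms`, `CS26-1-package`). Take it as an
explicit hypothesis; nothing asserted. [claim: Kim2025RefinedTNC, status: under-review]
[cite: KimKimSun2020, Thm. 1.1 and (Tam) (p. 4), §1.3 (p. 6), Assumption 4.2 and Lemma 4.3 (p. 12), §7.4 (p. 20), §8.2.2]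
[cite: Sakamoto2024KolyvaginThree, Thm. 1.1 and Thm. 8.5] [cite: MazurRubin2004, §3.5 (H.4) and Thm. 5.3.10]
[cite: Kobayashi2003, §5 (p. 10), Prop. 7.1 ii) (p. 12)] -/
def thm11_katoMainIdentity_of_kuriharaNumber_ne_zero_three_OPEN : Prop :=
  ∀ (W : WeierstrassCurve ℚ) [W.IsElliptic] [W.IsGloballyMinimal] (p : ℕ) [Fact p.Prime]
    [ContinuousSMul ℤ_[p] (W.tateModule p)] [Module.Free ℤ_[p] (W.tateModule p)]
    [Module.Finite ℤ_[p] (W.tateModule p)]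
    {N : ℕ} [NeZero N] (f : CuspForm (Gamma0 N) 2) (ϖ : ℚ)
    (κ : ZpExtension ℚ p) (γ : absoluteGaloisGroup ℚ),
  -- the frame of Kobayashi's `η = 1` package, at `p = 3`
    p = 3 → W.HasGoodReductionAtPrime p → W.frobeniusTrace p = 0 → IsNewformOf W f →
    (ϖ : ℝ) * W.realPeriodRat = plusPeriod f →
    κ.IsCyclotomic → κ.IsTopGenerator γ → IsCyclotomicVariable p γ →
  -- (Im): `ρ̄` onto and the `p`-adic tower onto; (Tam), first clause, on the multiplicative primes
    W.HasSurjectiveModNGaloisRep p → (∀ n : ℕ, W.HasSurjectiveModNGaloisRep (p ^ n : ℕ)) →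
    (∀ (q : ℕ) [Fact q.Prime], W.HasMultiplicativeReductionAtPrime q →
      (W.HasSplitMultiplicativeReductionAtPrime q → ¬ p ∣ q - 1) ∧
      (¬ W.HasSplitMultiplicativeReductionAtPrime q → ¬ p ∣ q + 1)) →
  -- the period transfer (canonical vs Néron period, units apart)
    (∃ u : ℚ, ‖(u : ℚ_[p])‖ = 1 ∧ W.realPeriodRat = u * plusPeriod f) →
  -- the certificate: a unit Kurihara number at a cyclic level `n ∈ 𝒩₁`
  ∀ (n : ℕ) [NeZero n], Kato.IsKolyvaginProduct W p 1 n →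
    (∀ (ℓ : ℕ) [Fact ℓ.Prime], ℓ ∣ n →
      Nat.card {P : ((WeierstrassCurve.integralModelInt W).map
          (Int.castRingHom (ZMod ℓ))).toAffine.Point // p • P = 0} ≤ p) →
  ∀ ψ : (ℓ : ℕ) → (ZMod ℓ)ˣ →* Multiplicative (ZMod (p ^ 1)),
    (∀ ℓ ∈ n.primeFactors, Function.Surjective (ψ ℓ)) →
    kuriharaNumber f (p ^ 1) n ψ ≠ 0 →
  -- Kato's main identity, read on the pinned objects through the `η = 1` package
  ∀ (ε : ℤˣ) (I : Kato2004.IwasawaH1Data W p κ γ) (Y : W.FineSelmerDualData κ γ),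
    ∃ d : Kobayashi2003.SignedColemanKatoData W p f ϖ κ γ ε I,
      Module.charIdeal (IwasawaAlgebra p) Y.X =
        Module.charIdeal (IwasawaAlgebra p) (I.H ⧸ d.Z)

end Literature.NumberTheory.EllipticCurves.KimKimSun2020

end
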